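import Summits.ResolutionOfSingularities.ResolutionOfSingularities.Theorems.FrobeniusClosingSteerNonRationalWindowBiConeForms
import HarnessLib

/-!
# Crux `Steer` (stmt-ResolutionOfSingularities-16345), β-leaf debt K-β0(a) — (T1) the TOP homogeneous component is translation-invariant
  (res-D-pv-053 g9; res-L0-w41-plan-1 RULING 317 (c); memo `D/res-D-pv-053/K-BETA0A-SCOPE.md` §5 (T1); consumer: the K-β0(a) run induction, which
  reads `ReturnId.homogeneousComponent_translate_eq_of_sq_congr` / `SatParity.…` back in untranslated coordinates)

OURS (campaign `res-hironaka`, rung L ★L-G4, slot W4.1). Pure polynomial algebra; nothing here is a statement of H. Hironaka's manuscript [Hironaka2017]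
(status: under review). AI-written; AI review is weaker than expert review. Def-free, 0 sorries.

* `homogeneousComponent_mul_of_totalDegree_le` — `deg φ ≤ p`, `deg ψ ≤ q` ⇒ the degree-`(p+q)` component of `φ·ψ` is `φ_p · ψ_q`.
* `homogeneousComponent_X_add_C_pow` — the degree-`n` component of `(X_i + a)^n` is `X_i^n`.
* `homogeneousComponent_translate_monomial`, **`homogeneousComponent_translate_of_isHomogeneous`** — for a FORM `P` of degree `d`, the degree-`d`
  component of the translate `P(T + a)` is `P` itself; `homogeneousComponent_translate_eq_zero_of_totalDegree_lt` — a polynomial of total degree `< d`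
  contributes nothing in degree `d` after translation; `homogeneousComponent_translate_add` — the combination used by the run induction
  (`(P + θ)(T + a)` has degree-`d` component `P` when `deg θ < d`).

[folklore]
-/

noncomputable section

-- `Summit.<S>.<S>.…` duplicates the summit name by design (single-problem summit).
set_option linter.dupNamespace false

open MvPolynomial

namespace Summit.ResolutionOfSingularities.ResolutionOfSingularities.Theorems.SwitchingDichotomy.ArithTransport

namespace ConeTranslate

open NonRationalWindow.BiConeForms

variable {k : Type*} [Field k] {σ : Type*}

/-- **Top components multiply.** If `deg φ ≤ p` and `deg ψ ≤ q` then `(φ·ψ)_{p+q} = φ_p · ψ_q`. [folklore] -/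
theorem homogeneousComponent_mul_of_totalDegree_le {φ ψ : MvPolynomial σ k} {p q : ℕ} (hφ : φ.totalDegree ≤ p) (hψ : ψ.totalDegree ≤ q) :
    homogeneousComponent (p + q) (φ * ψ) = homogeneousComponent p φ * homogeneousComponent q ψ := by
  classical
  ext m
  rw [coeff_homogeneousComponent, coeff_mul, coeff_mul]
  by_cases hm : m.degree = p + q
  · rw [if_pos hm]
    refine Finset.sum_congr rfl fun x hx => ?_
    rw [coeff_homogeneousComponent, coeff_homogeneousComponent]
    have hsum : x.1.degree + x.2.degree = p + q := by
      rw [← map_add, Finset.HasAntidiagonal.mem_antidiagonal.mp hx, hm]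
    by_cases h1 : x.1.degree = p
    · have h2 : x.2.degree = q := by omega
      rw [if_pos h1, if_pos h2]
    · rw [if_neg h1, zero_mul]
      rcases Nat.lt_or_gt_of_ne h1 with hlt | hgt
      · -- then `deg x.2 > q`: its coefficient in `ψ` vanishes
        have hq : q < x.2.degree := by omega
        have : coeff x.2 ψ = 0 := by
          refine coeff_eq_zero_of_totalDegree_lt ?_
          change ψ.totalDegree < x.2.degree
          omega
        rw [this, mul_zero]
      · have : coeff x.1 φ = 0 := by
          refine coeff_eq_zero_of_totalDegree_lt ?_
          change φ.totalDegree < x.1.degree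
          omega
        rw [this, zero_mul]
  · rw [if_neg hm]
    symm
    refine Finset.sum_eq_zero fun x hx => ?_
    rw [coeff_homogeneousComponent, coeff_homogeneousComponent]
    have hsum : x.1.degree + x.2.degree = m.degree := by
      rw [← map_add, Finset.HasAntidiagonal.mem_antidiagonal.mp hx]
    by_cases h1 : x.1.degree = p
    · rw [if_pos h1, if_neg (by omega), mul_zero]
    · rw [if_neg h1, zero_mul]

/-- The degree-`n` component of `(X_i + a)^n` is `X_i^n`. [folklore] -/
theorem homogeneousComponent_X_add_C_pow (i : σ) (a : k) (n : ℕ) :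
    homogeneousComponent n ((X i + C a : MvPolynomial σ k) ^ n) = X i ^ n := by
  classical
  induction n with
  | zero =>
    rw [pow_zero, pow_zero]
    have hmem : (1 : MvPolynomial σ k) ∈ homogeneousSubmodule σ k 0 := by
      rw [mem_homogeneousSubmodule]; exact isHomogeneous_one σ k
    rw [homogeneousComponent_of_mem hmem, if_pos rfl]
  | succ n ih =>
    have hdeg1 : (X i + C a : MvPolynomial σ k).totalDegree ≤ 1 :=
      (totalDegree_add _ _).trans (max_le (totalDegree_X _).le (by rw [totalDegree_C]; exact zero_le_one))
    have hdegn : ((X i + C a : MvPolynomial σ k) ^ n).totalDegree ≤ n :=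
      (totalDegree_pow _ _).trans (by simpa using Nat.mul_le_mul_left n hdeg1)
    rw [pow_succ, pow_succ, homogeneousComponent_mul_of_totalDegree_le hdegn hdeg1, ih]
    congr 1
    rw [map_add]
    have hX : (X i : MvPolynomial σ k) ∈ homogeneousSubmodule σ k 1 := by
      rw [mem_homogeneousSubmodule]; exact isHomogeneous_X k i
    have hC : (C a : MvPolynomial σ k) ∈ homogeneousSubmodule σ k 0 := by
      rw [mem_homogeneousSubmodule]; exact isHomogeneous_C σ a
    rw [homogeneousComponent_of_mem hX, if_pos rfl, homogeneousComponent_of_mem hC, if_neg one_ne_zero, add_zero]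

/-- The degree-`|m|` component of the translate of the monomial `c·T^m` is `c·T^m`. [folklore] -/
theorem homogeneousComponent_translate_monomial (a : σ → k) (m : σ →₀ ℕ) (c : k) :
    homogeneousComponent m.degree (bind₁ (fun i => X i + C (a i)) (monomial m c)) = monomial m c := by
  classical
  rw [bind₁_monomial, homogeneousComponent_C_mul, monomial_eq, Finsupp.prod]
  congr 1
  -- over the support of `m`, by induction
  have key : ∀ s : Finset σ, homogeneousComponent (∑ i ∈ s, m i) (∏ i ∈ s, (X i + C (a i) : MvPolynomial σ k) ^ m i) =
      ∏ i ∈ s, X i ^ m i := by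
    intro s
    induction s using Finset.induction_on with
    | empty =>
      rw [Finset.sum_empty, Finset.prod_empty, Finset.prod_empty]
      have hmem : (1 : MvPolynomial σ k) ∈ homogeneousSubmodule σ k 0 := by
        rw [mem_homogeneousSubmodule]; exact isHomogeneous_one σ k
      rw [homogeneousComponent_of_mem hmem, if_pos rfl]
    | insert i s hi ih =>
      rw [Finset.sum_insert hi, Finset.prod_insert hi, Finset.prod_insert hi]
      have hdeg1 : ((X i + C (a i) : MvPolynomial σ k) ^ m i).totalDegree ≤ m i := by
        refine (totalDegree_pow _ _).trans ?_
        have : (X i + C (a i) : MvPolynomial σ k).totalDegree ≤ 1 :=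
          (totalDegree_add _ _).trans (max_le (totalDegree_X _).le (by rw [totalDegree_C]; exact zero_le_one))
        simpa using Nat.mul_le_mul_left (m i) this
      have hdeg2 : (∏ j ∈ s, (X j + C (a j) : MvPolynomial σ k) ^ m j).totalDegree ≤ ∑ j ∈ s, m j := by
        refine (totalDegree_finsetProd _ _).trans (Finset.sum_le_sum fun j _ => ?_)
        refine (totalDegree_pow _ _).trans ?_
        have : (X j + C (a j) : MvPolynomial σ k).totalDegree ≤ 1 :=
          (totalDegree_add _ _).trans (max_le (totalDegree_X _).le (by rw [totalDegree_C]; exact zero_le_one))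
        simpa using Nat.mul_le_mul_left (m j) this
      rw [homogeneousComponent_mul_of_totalDegree_le hdeg1 hdeg2, homogeneousComponent_X_add_C_pow, ih]
  exact key m.support

/-- **The top component is translation-invariant**: for a FORM `P` of degree `d`, the degree-`d` component of `P(T + a)` is `P`. [folklore] -/
theorem homogeneousComponent_translate_of_isHomogeneous (a : σ → k) {P : MvPolynomial σ k} {d : ℕ} (hP : P.IsHomogeneous d) :
    homogeneousComponent d (bind₁ (fun i => X i + C (a i)) P) = P := by
  classical
  conv_lhs => rw [P.as_sum]
  rw [map_sum, map_sum]
  conv_rhs => rw [P.as_sum]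
  refine Finset.sum_congr rfl fun m hm => ?_
  have hmd : m.degree = d := by rw [Finsupp.degree_eq_weight_one]; exact hP (mem_support_iff.mp hm)
  rw [← hmd, homogeneousComponent_translate_monomial]

/-- A polynomial of total degree `< d` contributes nothing in degree `d` after translation. [folklore] -/
theorem homogeneousComponent_translate_eq_zero_of_totalDegree_lt (a : σ → k) {θ : MvPolynomial σ k} {d : ℕ} (hθ : θ.totalDegree < d) :
    homogeneousComponent d (bind₁ (fun i => X i + C (a i)) θ) = 0 :=
  homogeneousComponent_eq_zero d _ (lt_of_le_of_lt (totalDegree_bind₁_translate_le a θ) hθ)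

/-- **The reading used by the run induction**: for a form `P` of degree `d` and `θ` of total degree `< d`, the degree-`d` component of the
translate of `P + θ` is `P`. [folklore] -/
theorem homogeneousComponent_translate_add (a : σ → k) {P θ : MvPolynomial σ k} {d : ℕ} (hP : P.IsHomogeneous d) (hθ : θ.totalDegree < d) :
    homogeneousComponent d (bind₁ (fun i => X i + C (a i)) (P + θ)) = P := by
  rw [map_add, map_add, homogeneousComponent_translate_of_isHomogeneous a hP, homogeneousComponent_translate_eq_zero_of_totalDegree_lt a hθ,
    add_zero]

end ConeTranslate

end Summit.ResolutionOfSingularities.ResolutionOfSingularities.Theorems.SwitchingDichotomy.ArithTransport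

end
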